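import Mathlib

/-!
# SoloInformed — the `k = 3` line count at `t = 1` (E(7,3))

Kernel rung of the solo-informed line ((16.12)(d), plan s26 item 2).  When two of the three unit
forms vanish identically on the pencil of the eight Kummer lines of a rigid `r⁻ = 1`, `t = 1` cell
field, the lines carrying a cubic Kummer class are the zeros on `ℙ¹(𝔽₇)` of a binary CUBIC form
`F(x, y) = a x³ + b x² y + c x y² + d y³`.  Counting the points `(1 : y)`, `y ∈ 𝔽₇`, and `(0 : 1)`
(where `F(0, 1) = d`), this file certifies the possible numbers of such lines: `0, 1, 2, 3` or `8`,
never `4, …, 7` (`soloInformed_cubicForm_zerosP1_seven`), with `8` only for the zero form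
(`soloInformed_cubicForm_zerosP1_seven_eq_eight`), and the `p = 5` companion (`0, 1, 2, 3` or `6`).
The count is literally `p1Zeros p F` of `SoloInformedOneOrSix` (not imported here, to keep the file
self-contained).  Pure finite-field counting by `decide`; no number theory is asserted.
-/

namespace Summit.Langlands.Langlands.Theorems

/-- `p = 7`, `k = 3` at `t = 1`: a binary cubic form over `𝔽₇` has `0, 1, 2, 3` or `8` zeros on
`ℙ¹(𝔽₇)` (zeros `(1 : y)` counted by the filter, the point `(0 : 1)` by the `if`). -/
theorem soloInformed_cubicForm_zerosP1_seven (a b c d : ZMod 7) :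
    (Finset.univ.filter fun y : ZMod 7 => a + b * y + c * y ^ 2 + d * y ^ 3 = 0).card
        + (if d = 0 then 1 else 0) ∈ ({0, 1, 2, 3, 8} : Finset ℕ) := by
  revert a b c d; decide

/-- … and all `8` points are zeros only for the zero form. -/
theorem soloInformed_cubicForm_zerosP1_seven_eq_eight (a b c d : ZMod 7)
    (h : (Finset.univ.filter fun y : ZMod 7 => a + b * y + c * y ^ 2 + d * y ^ 3 = 0).card
        + (if d = 0 then 1 else 0) = 8) :
    a = 0 ∧ b = 0 ∧ c = 0 ∧ d = 0 := by
  revert a b c d; decide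

/-- `p = 5` companion: a binary cubic form over `𝔽₅` has `0, 1, 2, 3` or `6` zeros on `ℙ¹(𝔽₅)`. -/
theorem soloInformed_cubicForm_zerosP1_five (a b c d : ZMod 5) :
    (Finset.univ.filter fun y : ZMod 5 => a + b * y + c * y ^ 2 + d * y ^ 3 = 0).card
        + (if d = 0 then 1 else 0) ∈ ({0, 1, 2, 3, 6} : Finset ℕ) := by
  revert a b c d; decide

end Summit.Langlands.Langlands.Theorems
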